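import Summits.ResolutionOfSingularities.ResolutionOfSingularities.Theorems.UniversalCellsCampaignW82FamilyResolutionInsepOneFibre
import Mathlib.RingTheory.AlgebraicIndependent.Basic
import HarnessLib

/-!
# [OURS · L1 W8.2] RESOLUTION IN PENCILS WITH RADICIAL BASE EXTENSION, «ONE CLOSED FIBRE» FORM — campaign
# statement (door 1, `UniversalCells` / `PrimeFieldToPerfect`), Theses-free module

Cell `res-hironaka` (run/shared/lean/pub/res-hironaka/), LADDER-RESOLUTION rung L (RESCUE), slot W8.2 of
plan/RESCUE-SEED.md («PRIME-FIELD / UNIVERSALITY TRANSFER instead of descent: resolve over 𝔽_p or 𝔽̄_p and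
transfer FAMILIES»). FIRST DOOR: route `UniversalCells`, item `PrimeFieldToPerfect`
(stmt-ResolutionOfSingularities-15233; kernel of record `CampaignW82.ClimbRatFuncPerf p`: resolution over a
perfect `M` ⇒ resolution over the perfect purely inseparable extensions `L` of `M(t)`). Self-typed by
res-L1-s82-pv-2 (gen 6) under the rung-B precedent, as the door-1 twin of
`Theorems/UniformComplexityCampaignW82PencilResolutionOneFibre.lean` (p546090) and the pencil restriction of
`CampaignW82.FamilyResolutionInsepOneFibre p k` (p548038). NOTHING is proved about resolution of
singularities here and nothing is asserted: one `def` and one pure-logic anchor.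

WHY THIS FILE. The kernel `ClimbRatFuncPerf p` is a statement about ONE-PARAMETER families: a variety over
`L ⊇ M(t)` (perfect, purely inseparable over `M(t)`) spreads over a finitely generated `M`-subalgebra
`R ⊆ L`, of transcendence degree `≤ trdeg_M L = 1` — a PENCIL over `M`. The crux kernel's lead c3 phrased
the residual exactly so (tree file `Summits/…/Cruxes/PrimeFieldToPerfect/KERNEL-c3.md` §1, (5.1): «for
every projective flat `𝒴 → 𝔸¹_M`-open … some Frobenius pullback admits, over a dense open of the base, a
modification with ONE smooth closed fibre»). This module types that pencil form with the one-closed-fibre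
radicial datum of p548038, for bases `A` with `Algebra.trdeg k A ≤ 1`. Prover's theorem (gen 6, links
leaf): `ClimbRatFuncPerf p ⇐ ∀ M` perfect of characteristic `p`, Res(`M`) `→ PencilResolutionInsepOneFibre
p M`, and `PrimeFieldTransferAt p ↔ (PrimeFieldRes p → ∀ M …)`; also resolution over all perfect fields of
characteristic `p` `↔ ∀ M` perfect, `PencilResolutionInsepOneFibre p M` (pencils over the point already
contain resolution over `M`).

BUILD RULE (cell, director-resolution 2026-08-26T18:53:29Z (B)): OURS vocabulary file, THESES-FREE BY BIRTH.

HONEST FRAMING. The `def` below is OURS — a campaign statement that REPLACES THE ROLE of a printed item of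
H. Hironaka's manuscript *Resolution of singularities in positive characteristics* (2017-03-23, [Hironaka2017],
lit key `paper:url-3343fd9e678b`) — namely §17 ¶2, p.89 l.59–62 (the variety over a field of transcendence
degree `d` as a family over the prime field — here `d = 1`, a PENCIL; `S17Methodology.U89_3`): what must be
done to a pencil of varieties over a perfect field (ONE closed fibre resolved, FLATLY, after a RADICIAL base
change of the curve) for resolution to climb from `M` to `M(t)^{perf}`; NOT a statement of the manuscript.
Hironaka's statements are CANDIDATES under adjudication (D-0012/D-0089); nothing here is attributed to the
author and no verdict on the manuscript is implied. AI typing, weaker than expert review.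

VACUITY SELF-CHECK (`p` prime, `k` perfect of characteristic `p`): not trivially true — at `A = k`
(`trdeg = 0`) the datum is a resolution of the given integral proper `k`-scheme (open in dimension `≥ 4`);
not trivially false — implied by `FamilyResolutionInsepOneFibre p k` (anchor), hence by `PerfectRes p`.

## References (vocabulary and locators only; nothing cited as a premise)
* H. Hironaka, ms. 2017-03-23, §17 ¶2 p.89 l.59–62 — under adjudication, quoted for the role replaced, not
  asserted. [Hironaka2017]
* A. Grothendieck, J. Dieudonné, EGA IV₃ (1966) Thm. 12.2.4 (iii). [EGAIV3]
* Tree: `Summits/…/Cruxes/PrimeFieldToPerfect/KERNEL-c3.md` §1, (5.1) — cell file, OURS.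
-/

noncomputable section

set_option linter.dupNamespace false -- mandated namespace of this single-conjunct summit

open _root_.CategoryTheory _root_.CategoryTheory.Limits _root_.AlgebraicGeometry
open Literature.AlgebraicGeometry.Resolution

namespace Summit.ResolutionOfSingularities.ResolutionOfSingularities.Theorems.CampaignW82

/-- [OURS · L1 W8.2 door 1] replaces the role of §17 ¶2, p.89 l.59–62 (the variety over a field of
transcendence degree `d` as a family — here `d = 1`, a PENCIL over a perfect field; `S17Methodology.U89_3`) in
the one-closed-fibre radicial form; NOT a statement of the manuscript. **RESOLUTION IN PENCILS WITH RADICIAL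
BASE EXTENSION, ONE-CLOSED-FIBRE FORM, over `k`, exponent prime `p`.** For every finitely generated `k`-domain
`A` of TRANSCENDENCE DEGREE `≤ 1` over `k` (`Algebra.trdeg k A ≤ 1`) and every PROPER `f : 𝒳 → Spec A` whose
radicial generic fibre `𝒳 ×_A Spec L` is integral for some perfect `L` radicial over `A` (injective `A → L`,
every `x : L` with `b · x ^ (p ^ n) = a`, `a, b ∈ A`, `b ≠ 0`), there exist a domain `A'` with an INJECTIVE,
FINITE-TYPE, RADICIAL `A`-algebra structure, `𝒴`, `G : 𝒴 → 𝒳' := 𝒳 ×_A Spec A'`, an open `W ⊆ 𝒳'` and a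
CLOSED point `s` of `Spec A'` such that: `G` is PROPER; `G` restricts to an ISOMORPHISM over `W`; `W` meets the
fibre of `𝒳'` over `s`; `q : 𝒴 → Spec A'` is FLAT AT THE POINTS OVER `s`; the fibre `q⁻¹(s) → Spec κ(s)` is
SMOOTH. VERBATIM the clause of `FamilyResolutionInsepOneFibre p k` (p548038) restricted to bases of
transcendence degree `≤ 1` (anchor `pencilResolutionInsepOneFibre_of_familyResolutionInsepOneFibre`). Prover's
theorems (gen 6, links leaf): `ClimbRatFuncPerf p ⇐ ∀ M` perfect, Res(`M`) `→ PencilResolutionInsepOneFibre p M`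
(E7 over the finitely generated `M`-subalgebras of `L`, `trdeg_M L = 1` by `trdeg_add_eq`); `PerfectRes`-type
resolution `↔ ∀ M` perfect, `PencilResolutionInsepOneFibre p M`. Barrier bookkeeping: the radicial `A → A'` is
the purely inseparable base change of the kernel (a finite level of the Frobenius tower of the curve); the
statement asks for ONE smooth closed fibre FLATLY after it — not for regularity of a total space. Vacuity
(`k` perfect of characteristic `p`): not trivially true (`A = k`: resolution of the given scheme); not trivially
false (⇐ `FamilyResolutionInsepOneFibre p k` ⇐ `PerfectRes p`). Composite `p`: not intended. [folklore] -/
def PencilResolutionInsepOneFibre (p : ℕ) (k : Type) [Field k] : Prop :=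
  ∀ (A : Type) [CommRing A] [IsDomain A] [Algebra k A], Algebra.FiniteType k A → Algebra.trdeg k A ≤ 1 →
    ∀ (𝒳 : Scheme.{0}) (f : 𝒳 ⟶ Spec (.of A)), IsProper f →
      (∃ (L : Type) (_ : Field L) (_ : PerfectField L) (_ : Algebra A L),
          Function.Injective (algebraMap A L) ∧
          (∀ x : L, ∃ (n : ℕ) (a b : A), b ≠ 0 ∧ algebraMap A L b * x ^ p ^ n = algebraMap A L a) ∧
          IsIntegral (pullback f (Spec.map (CommRingCat.ofHom (algebraMap A L))))) →
      ∃ (A' : Type) (_ : CommRing A') (_ : IsDomain A') (_ : Algebra A A'),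
        Function.Injective (algebraMap A A') ∧ Algebra.FiniteType A A' ∧
        (∀ x : A', ∃ (n : ℕ) (a b : A), b ≠ 0 ∧ algebraMap A A' b * x ^ p ^ n = algebraMap A A' a) ∧
        ∃ (𝒴 : Scheme.{0})
          (G : 𝒴 ⟶ pullback f (Spec.map (CommRingCat.ofHom (algebraMap A A'))))
          (W : (pullback f (Spec.map (CommRingCat.ofHom (algebraMap A A')))).Opens)
          (s : ↥(Spec (.of A'))),
          IsClosed ({s} : Set ↥(Spec (.of A'))) ∧
          IsProper G ∧
          IsIso (G ∣_ W) ∧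
          (∃ x : ↥(pullback f (Spec.map (CommRingCat.ofHom (algebraMap A A')))),
            x ∈ W ∧ (pullback.snd f (Spec.map (CommRingCat.ofHom (algebraMap A A')))) x = s) ∧
          (∀ y : ↥𝒴, (G ≫ pullback.snd f (Spec.map (CommRingCat.ofHom (algebraMap A A')))) y = s →
            ((G ≫ pullback.snd f (Spec.map (CommRingCat.ofHom (algebraMap A A')))).stalkMap y).hom.Flat) ∧
          Smooth ((G ≫ pullback.snd f (Spec.map (CommRingCat.ofHom (algebraMap A A')))).fiberToSpecResidueField s)

/-- Anchor (pure logic): the door-1 pencil form is the restriction of `FamilyResolutionInsepOneFibre p k` to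
bases of transcendence degree `≤ 1`. [folklore] -/
theorem pencilResolutionInsepOneFibre_of_familyResolutionInsepOneFibre {p : ℕ} {k : Type} [Field k]
    (h : FamilyResolutionInsepOneFibre p k) : PencilResolutionInsepOneFibre p k :=
  fun A _ _ _ hA _ 𝒳 f hf hL => h A hA 𝒳 f hf hL

end Summit.ResolutionOfSingularities.ResolutionOfSingularities.Theorems.CampaignW82

end
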